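import Mathlib.Algebra.Homology.DerivedCategory.Ext.Basic
import Mathlib.CategoryTheory.Limits.Shapes.Biproducts
import Mathlib.CategoryTheory.Preadditive.Biproducts
import Mathlib.CategoryTheory.Sites.SheafCohomology.Basic
import Mathlib.Algebra.Category.ModuleCat.Sheaf.Free
import Mathlib.Algebra.Category.ModuleCat.Sheaf.Limits
import HarnessLib

/-!
# `Ext` and sheaf cohomology of finite direct sums

For an abelian category `C` with `Ext`-groups (`HasExt`), an object `A` and a finite biproduct
`⨁ᵢ Xᵢ` (`[HasBiproduct X]`; Mathlib's `Abelian.hasFiniteBiproducts` is a theorem, not an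
instance), the functor `Extⁿ(A, –)` (`x ↦ x ∘ [f] = Ext.comp x (Ext.mk₀ f)`) commutes with the sum:

* `Ext.eq_sum_comp_π_comp_ι` — reconstruction `x = ∑ᵢ (x ∘ [πᵢ]) ∘ [ιᵢ]` (`∑ πᵢ ≫ ιᵢ = 𝟙`);
* `Ext.ext_of_comp_π`, `Ext.comp_π_bijective` — `x ↦ (x ∘ [πᵢ])ᵢ : Extⁿ(A, ⨁ᵢ Xᵢ) → ∏ᵢ Extⁿ(A, Xᵢ)`
  is bijective (the `AddEquiv` is Mathlib's `Ext.addEquivBiproduct`; binary: `Ext.addEquivBiprod`);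
* **transfer**: `Extⁿ(A, ⨁ᵢ Xᵢ)` has no `m`-torsion iff no `Extⁿ(A, Xᵢ)` has
  (`Ext.torsionFree_biproduct_iff`, binary `Ext.torsionFree_biprod`), it vanishes if all
  `Extⁿ(A, Xᵢ)` do (`Ext.subsingleton_biproduct`), and both properties are invariant under
  `X ≅ Y` (`Ext.torsionFree_of_iso`, `Ext.comp_mk₀_hom_bijective`, `Ext.subsingleton_of_iso`);
* the same for sheaf cohomology `Hⁿ(F) = Extⁿ(ℤ, F)` of abelian sheaves (`Sheaf.H`, `Sheaf.H.map`):
  `Sheaf.H.map_π_bijective`, `Sheaf.H.torsionFree_biproduct(_iff)`, `Sheaf.H.torsionFree_of_iso`, …;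
* sheaves of modules: `SheafOfModules.toSheaf R` is additive, hence commutes with finite
  biproducts (`SheafOfModules.nonempty_toSheaf_biproduct_iso`), and on a finite type the free
  module `free I = ∐_I R` is `⨁_I R` (`SheafOfModules.nonempty_free_iso_biproduct`); so
  **`Hⁿ(R^I)` has no `m`-torsion as soon as `Hⁿ(R)` has none**
  (`SheafOfModules.H_toSheaf_free_torsionFree`, `…_torsionFree_of_iso_free` for `M ≅ R^I`).

Why: on the branch of the `p`-adic lifting argument for Hodge classes (X. Hu, arXiv:2507.12458,
§11; Bloch–Esnault–Kerz 2014) where the Hodge sheaves of the formal scheme are free,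
`Ωᵃ ≅ 𝒪^{C(d,a)}`, the `p`-torsion-freeness of `Hᵇ(𝒳, 𝒪)` must propagate to `Hᵇ(𝒳, Ωᵃ)`.
[folklore] Everything is proved; theorems only; no named facts. Torsion-freeness is phrased
elementwise (`∀ y, m • y = 0 → y = 0`) as in `Algebra/Homology/ExtModPowers`. Mathlib (pin v4.32)
used: `Ext.addEquivBiproduct/Biprod`, `Ext.comp_sum`, `Ext.sum_comp`, `Ext.mk₀_sum`,
`IsBilimit.total`, `Functor.mapBiproduct`, `biproduct.isoCoproduct`. NOT here: infinite sums or
products (`Algebra/Homology/ExtPi`: `Ext` and products under AB4*), anything about schemes.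
-/

namespace Literature.Algebra.Homology

open CategoryTheory CategoryTheory.Limits CategoryTheory.Abelian

universe w' w v u t v₁ u₁

/-- "No `m`-torsion" pulls back along an injective additive map `f : M → N` (fixed `m`; for all
`m ≠ 0` at once this is `torsionFree_of_injective` of `Algebra/Homology/ExactSequenceTorsion`).
[folklore] -/
theorem eq_zero_of_zsmul_eq_zero_of_injective {M N F : Type*} [AddCommGroup M] [AddCommGroup N]
    [FunLike F M N] [AddMonoidHomClass F M N] (f : F) (hf : Function.Injective f) {m : ℤ}
    (hN : ∀ y : N, m • y = 0 → y = 0) (x : M) (hx : m • x = 0) : x = 0 :=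
  hf ((hN (f x) (by rw [← map_zsmul, hx, map_zero])).trans (map_zero f).symm)

/-- A product of additive groups without `m`-torsion has no `m`-torsion. [folklore] -/
theorem torsionFree_pi {ι : Type*} {M : ι → Type*} [∀ i, AddCommGroup (M i)] {m : ℤ}
    (hM : ∀ i (y : M i), m • y = 0 → y = 0) (x : ∀ i, M i) (hx : m • x = 0) : x = 0 :=
  funext fun i => hM i (x i) (by rw [← Pi.smul_apply, hx, Pi.zero_apply])

/-- A binary product of additive groups without `m`-torsion has no `m`-torsion. [folklore] -/
theorem torsionFree_prod {M N : Type*} [AddCommGroup M] [AddCommGroup N] {m : ℤ}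
    (hM : ∀ y : M, m • y = 0 → y = 0) (hN : ∀ y : N, m • y = 0 → y = 0) (x : M × N)
    (hx : m • x = 0) : x = 0 :=
  Prod.ext (hM _ (by rw [← Prod.smul_fst, hx, Prod.fst_zero]))
    (hN _ (by rw [← Prod.smul_snd, hx, Prod.snd_zero]))

/-! ### `Extⁿ(A, –)` of a finite biproduct -/

section Ext

variable {C : Type u} [Category.{v} C] [Abelian C] [HasExt.{w} C] (A : C) {n : ℕ} {ι : Type t}
  (X : ι → C) [HasBiproduct X]

/-- `(y ∘ [ιᵢ]) ∘ [πᵢ] = y`: the inclusion of a summand is split, also on `Ext`. [folklore] -/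
theorem Ext.comp_ι_comp_π (i : ι) (y : Ext A (X i) n) :
    (y.comp (Ext.mk₀ (biproduct.ι X i)) (add_zero n)).comp (Ext.mk₀ (biproduct.π X i))
      (add_zero n) = y := by
  rw [Ext.comp_assoc_of_second_deg_zero, Ext.mk₀_comp_mk₀, biproduct.ι_π_self, Ext.comp_mk₀_id]

/-- Push-forward along a summand inclusion, `y ↦ y ∘ [ιᵢ] : Extⁿ(A, Xᵢ) → Extⁿ(A, ⨁ᵢ Xᵢ)`, is
injective. [folklore] -/
theorem Ext.comp_ι_injective (i : ι) :
    Function.Injective fun y : Ext A (X i) n =>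
      y.comp (Ext.mk₀ (biproduct.ι X i)) (add_zero n) := by
  intro y y' h
  have h' := congrArg (fun z : Ext A (⨁ X) n => z.comp (Ext.mk₀ (biproduct.π X i)) (add_zero n)) h
  simpa only [Ext.comp_ι_comp_π] using h'

/-- **A summand inherits torsion-freeness**: `Extⁿ(A, Xᵢ) ↪ Extⁿ(A, ⨁ᵢ Xᵢ)`. [folklore] -/
theorem Ext.torsionFree_of_biproduct {m : ℤ} (h : ∀ x : Ext A (⨁ X) n, m • x = 0 → x = 0)
    (i : ι) (y : Ext A (X i) n) (hy : m • y = 0) : y = 0 :=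
  eq_zero_of_zsmul_eq_zero_of_injective ((Ext.mk₀ (biproduct.ι X i)).postcomp A (add_zero n))
    (Ext.comp_ι_injective A X i) h y hy

/-- **Reconstruction from components**: `x = ∑ᵢ (x ∘ [πᵢ]) ∘ [ιᵢ]` for `x ∈ Extⁿ(A, ⨁ᵢ Xᵢ)`,
from `∑ᵢ πᵢ ≫ ιᵢ = 𝟙` (`IsBilimit.total`) and biadditivity of `Ext.comp`. [folklore] -/
theorem Ext.eq_sum_comp_π_comp_ι [Fintype ι] (x : Ext A (⨁ X) n) :
    x = ∑ i, (x.comp (Ext.mk₀ (biproduct.π X i)) (add_zero n)).comp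
      (Ext.mk₀ (biproduct.ι X i)) (add_zero n) := by
  have htot : ∑ i, biproduct.π X i ≫ biproduct.ι X i = 𝟙 (⨁ X) :=
    IsBilimit.total (biproduct.isBilimit X)
  symm
  simp only [Ext.comp_assoc_of_second_deg_zero, Ext.mk₀_comp_mk₀, ← Ext.comp_sum, ← Ext.mk₀_sum,
    htot, Ext.comp_mk₀_id]

/-- The `j`-th component of `∑ᵢ yᵢ ∘ [ιᵢ]` is `y_j` (`ιᵢ ≫ πⱼ = δᵢⱼ`). [folklore] -/
theorem Ext.sum_comp_ι_comp_π [Fintype ι] (y : ∀ i, Ext A (X i) n) (j : ι) :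
    (∑ i, (y i).comp (Ext.mk₀ (biproduct.ι X i)) (add_zero n)).comp
      (Ext.mk₀ (biproduct.π X j)) (add_zero n) = y j := by
  simp only [Ext.sum_comp, Ext.comp_assoc_of_second_deg_zero, Ext.mk₀_comp_mk₀]
  rw [Finset.sum_eq_single j _ (by simp), biproduct.ι_π_self, Ext.comp_mk₀_id]
  intro i _ hij
  rw [biproduct.ι_π_ne _ hij, Ext.mk₀_zero, Ext.comp_zero]

variable [Finite ι]

/-- **Uniqueness**: classes in `Extⁿ(A, ⨁ᵢ Xᵢ)` with equal components agree. [folklore] -/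
theorem Ext.ext_of_comp_π {x y : Ext A (⨁ X) n}
    (h : ∀ i, x.comp (Ext.mk₀ (biproduct.π X i)) (add_zero n) =
      y.comp (Ext.mk₀ (biproduct.π X i)) (add_zero n)) : x = y := by
  obtain ⟨_⟩ := nonempty_fintype ι
  rw [Ext.eq_sum_comp_π_comp_ι A X x, Ext.eq_sum_comp_π_comp_ι A X y]
  exact Finset.sum_congr rfl fun i _ => by rw [h i]

/-- A class in `Extⁿ(A, ⨁ᵢ Xᵢ)` vanishes iff all its components do. [folklore] -/
theorem Ext.eq_zero_iff_forall_comp_π_eq_zero (x : Ext A (⨁ X) n) :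
    x = 0 ↔ ∀ i, x.comp (Ext.mk₀ (biproduct.π X i)) (add_zero n) = 0 :=
  ⟨fun h i => by rw [h, Ext.zero_comp],
    fun h => Ext.ext_of_comp_π A X fun i => by rw [h i, Ext.zero_comp]⟩

/-- **`Extⁿ(A, ⨁ᵢ Xᵢ) ≅ ∏ᵢ Extⁿ(A, Xᵢ)`**: `x ↦ (x ∘ [πᵢ])ᵢ` is bijective (injective by
`Ext.ext_of_comp_π`; every family `(yᵢ)` is the family of components of `∑ᵢ yᵢ ∘ [ιᵢ]`, **joint
surjectivity**); the `AddEquiv` is Mathlib's `Ext.addEquivBiproduct`. [folklore] -/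
theorem Ext.comp_π_bijective :
    Function.Bijective fun (x : Ext A (⨁ X) n) (i : ι) =>
      x.comp (Ext.mk₀ (biproduct.π X i)) (add_zero n) := by
  obtain ⟨_⟩ := nonempty_fintype ι
  exact ⟨fun _ _ h => Ext.ext_of_comp_π A X fun i => congr_fun h i,
    fun y => ⟨∑ i, (y i).comp (Ext.mk₀ (biproduct.ι X i)) (add_zero n),
      funext fun j => Ext.sum_comp_ι_comp_π A X y j⟩⟩

/-- **Torsion-freeness of `Extⁿ(A, ⨁ᵢ Xᵢ)` from the summands `Extⁿ(A, Xᵢ)`.** [folklore] -/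
theorem Ext.torsionFree_biproduct {m : ℤ} (hX : ∀ i (y : Ext A (X i) n), m • y = 0 → y = 0)
    (x : Ext A (⨁ X) n) (hx : m • x = 0) : x = 0 := by
  obtain ⟨_⟩ := nonempty_fintype ι
  exact eq_zero_of_zsmul_eq_zero_of_injective (Ext.addEquivBiproduct A (biproduct.isBilimit X) n)
    (Ext.addEquivBiproduct A (biproduct.isBilimit X) n).injective (torsionFree_pi hX) x hx

/-- `Extⁿ(A, ⨁ᵢ Xᵢ)` has no `m`-torsion iff no `Extⁿ(A, Xᵢ)` has. [folklore] -/
theorem Ext.torsionFree_biproduct_iff {m : ℤ} :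
    (∀ x : Ext A (⨁ X) n, m • x = 0 → x = 0) ↔ ∀ i (y : Ext A (X i) n), m • y = 0 → y = 0 :=
  ⟨Ext.torsionFree_of_biproduct A X, Ext.torsionFree_biproduct A X⟩

/-- **Vanishing transfer**: if all `Extⁿ(A, Xᵢ)` vanish, so does `Extⁿ(A, ⨁ᵢ Xᵢ)`. [folklore] -/
theorem Ext.subsingleton_biproduct [∀ i, Subsingleton (Ext A (X i) n)] :
    Subsingleton (Ext A (⨁ X) n) :=
  subsingleton_of_forall_eq 0 fun x =>
    (Ext.eq_zero_iff_forall_comp_π_eq_zero A X x).mpr fun _ => Subsingleton.elim _ _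

/-! ### Binary biproducts; transfer along isomorphisms -/

variable {A} {Y Z : C}

/-- Classes in `Extⁿ(A, Y ⊞ Z)` with the same components `x ∘ [fst]`, `x ∘ [snd]` agree (the
reconstruction `x = (x ∘ [fst]) ∘ [inl] + (x ∘ [snd]) ∘ [inr]` is `Ext.addEquivBiprod`).
[folklore] -/
theorem Ext.ext_of_comp_fst_snd {x y : Ext A (Y ⊞ Z) n}
    (h₁ : x.comp (Ext.mk₀ biprod.fst) (add_zero n) = y.comp (Ext.mk₀ biprod.fst) (add_zero n))
    (h₂ : x.comp (Ext.mk₀ biprod.snd) (add_zero n) = y.comp (Ext.mk₀ biprod.snd) (add_zero n)) :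
    x = y :=
  Ext.addEquivBiprod.injective (Prod.ext h₁ h₂)

/-- **Torsion-freeness of `Extⁿ(A, Y ⊞ Z)`** from that of `Extⁿ(A, Y)`, `Extⁿ(A, Z)`. [folklore] -/
theorem Ext.torsionFree_biprod {m : ℤ} (hY : ∀ y : Ext A Y n, m • y = 0 → y = 0)
    (hZ : ∀ y : Ext A Z n, m • y = 0 → y = 0) (x : Ext A (Y ⊞ Z) n) (hx : m • x = 0) : x = 0 :=
  eq_zero_of_zsmul_eq_zero_of_injective (Ext.addEquivBiprod (X := A) (Y₁ := Y) (Y₂ := Z) (n := n))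
    Ext.addEquivBiprod.injective (torsionFree_prod hY hZ) x hx

/-- `(x ∘ [e.hom]) ∘ [e.inv] = x`. [folklore] -/
theorem Ext.comp_hom_comp_inv (e : Y ≅ Z) (x : Ext A Y n) :
    (x.comp (Ext.mk₀ e.hom) (add_zero n)).comp (Ext.mk₀ e.inv) (add_zero n) = x := by
  rw [Ext.comp_assoc_of_second_deg_zero, Ext.mk₀_comp_mk₀, e.hom_inv_id, Ext.comp_mk₀_id]

/-- Post-composition with an isomorphism `Y ≅ Z` is a bijection `Extⁿ(A, Y) → Extⁿ(A, Z)`.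
[folklore] -/
theorem Ext.comp_mk₀_hom_bijective (e : Y ≅ Z) :
    Function.Bijective fun x : Ext A Y n => x.comp (Ext.mk₀ e.hom) (add_zero n) :=
  Function.bijective_iff_has_inverse.mpr
    ⟨fun y => y.comp (Ext.mk₀ e.inv) (add_zero n), Ext.comp_hom_comp_inv e,
      Ext.comp_hom_comp_inv e.symm⟩

/-- **Torsion-freeness of `Extⁿ(A, –)` is invariant under isomorphism.** [folklore] -/
theorem Ext.torsionFree_of_iso (e : Y ≅ Z) {m : ℤ} (hY : ∀ x : Ext A Y n, m • x = 0 → x = 0)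
    (z : Ext A Z n) (hz : m • z = 0) : z = 0 :=
  eq_zero_of_zsmul_eq_zero_of_injective ((Ext.mk₀ e.inv).postcomp A (add_zero n))
    (Ext.comp_mk₀_hom_bijective e.symm).1 hY z hz

/-- Vanishing of `Extⁿ(A, –)` is invariant under isomorphism. [folklore] -/
theorem Ext.subsingleton_of_iso (e : Y ≅ Z) [Subsingleton (Ext A Y n)] :
    Subsingleton (Ext A Z n) :=
  subsingleton_of_forall_eq 0 fun y => by
    rw [← Ext.comp_hom_comp_inv e.symm y, Subsingleton.elim (y.comp _ _) 0, Ext.zero_comp]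

end Ext

/-! ### Sheaf cohomology `Hⁿ(–) = Extⁿ(ℤ, –)` of finite direct sums of abelian sheaves -/

section Sheaf

variable {C : Type u} [Category.{v} C] {J : GrothendieckTopology C}
  [HasSheafify J AddCommGrpCat.{w}] [HasExt.{w'} (Sheaf J AddCommGrpCat.{w})] {n : ℕ}

section

variable {ι : Type t} [Finite ι] (F : ι → Sheaf J AddCommGrpCat.{w}) [HasBiproduct F]

/-- **`Hⁿ(⨁ᵢ Fᵢ) ≅ ∏ᵢ Hⁿ(Fᵢ)`** (abelian sheaves): `x ↦ (Hⁿ(πᵢ) x)ᵢ` is bijective. [folklore] -/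
theorem Sheaf.H.map_π_bijective :
    Function.Bijective fun (x : (⨁ F).H n) (i : ι) => Sheaf.H.map (biproduct.π F i) n x :=
  Ext.comp_π_bijective _ F

/-- **Torsion-freeness of `Hⁿ(⨁ᵢ Fᵢ)` from that of the `Hⁿ(Fᵢ)`** (abelian sheaves). [folklore] -/
theorem Sheaf.H.torsionFree_biproduct {m : ℤ} (hF : ∀ i (y : (F i).H n), m • y = 0 → y = 0)
    (x : (⨁ F).H n) (hx : m • x = 0) : x = 0 :=
  Ext.torsionFree_biproduct _ F hF x hx

/-- `Hⁿ(⨁ᵢ Fᵢ)` has no `m`-torsion iff no `Hⁿ(Fᵢ)` has. [folklore] -/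
theorem Sheaf.H.torsionFree_biproduct_iff {m : ℤ} :
    (∀ x : (⨁ F).H n, m • x = 0 → x = 0) ↔ ∀ i (y : (F i).H n), m • y = 0 → y = 0 :=
  Ext.torsionFree_biproduct_iff _ F

/-- Vanishing: `Hⁿ(Fᵢ) = 0` for all `i` forces `Hⁿ(⨁ᵢ Fᵢ) = 0`. [folklore] -/
theorem Sheaf.H.subsingleton_biproduct [∀ i, Subsingleton ((F i).H n)] :
    Subsingleton ((⨁ F).H n) :=
  Ext.subsingleton_biproduct _ F

end

variable {F G : Sheaf J AddCommGrpCat.{w}}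

/-- `Hⁿ(e.hom)` is bijective for an isomorphism `e : F ≅ G` of abelian sheaves. [folklore] -/
theorem Sheaf.H.map_bijective_of_iso (e : F ≅ G) : Function.Bijective (Sheaf.H.map e.hom n) :=
  Ext.comp_mk₀_hom_bijective e

/-- **Torsion-freeness of `Hⁿ` is invariant under isomorphism of sheaves.** [folklore] -/
theorem Sheaf.H.torsionFree_of_iso (e : F ≅ G) {m : ℤ} (hF : ∀ x : F.H n, m • x = 0 → x = 0)
    (y : G.H n) (hy : m • y = 0) : y = 0 :=
  Ext.torsionFree_of_iso e hF y hy

/-- `Hⁿ(F)` has no `m`-torsion iff `Hⁿ(G)` has none, for `F ≅ G`. [folklore] -/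
theorem Sheaf.H.torsionFree_iff_of_iso (e : F ≅ G) {m : ℤ} :
    (∀ x : F.H n, m • x = 0 → x = 0) ↔ ∀ y : G.H n, m • y = 0 → y = 0 :=
  ⟨Ext.torsionFree_of_iso e, Ext.torsionFree_of_iso e.symm⟩

/-- Vanishing of `Hⁿ` is invariant under isomorphism of sheaves. [folklore] -/
theorem Sheaf.H.subsingleton_of_iso (e : F ≅ G) [Subsingleton (F.H n)] :
    Subsingleton (G.H n) :=
  Ext.subsingleton_of_iso e

end Sheaf

/-! ### Sheaves of modules: `toSheaf` and finite direct sums, free modules of finite rank -/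

section SheafOfModules

variable {C : Type u₁} [Category.{v₁} C] {J : GrothendieckTopology C} (R : Sheaf J RingCat.{u})

section

variable {ι : Type t} [Finite ι] (M : ι → SheafOfModules.{v} R) [HasBiproduct M]
  [HasBiproduct fun i => (SheafOfModules.toSheaf R).obj (M i)]

/-- The forgetful functor from sheaves of `R`-modules to abelian sheaves commutes with finite
direct sums, `(⨁ᵢ Mᵢ)^{ab} ≅ ⨁ᵢ Mᵢ^{ab}` (it is additive; `Functor.mapBiproduct`). [folklore] -/
theorem SheafOfModules.nonempty_toSheaf_biproduct_iso :
    Nonempty ((SheafOfModules.toSheaf R).obj (⨁ M) ≅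
      ⨁ fun i => (SheafOfModules.toSheaf R).obj (M i)) := by
  haveI : PreservesBiproductsOfShape ι (SheafOfModules.toSheaf.{v} R) :=
    preservesBiproductsOfShape_of_preservesProductsOfShape _
  exact ⟨(SheafOfModules.toSheaf R).mapBiproduct M⟩

variable [HasSheafify J AddCommGrpCat.{v}] [HasExt.{w'} (Sheaf J AddCommGrpCat.{v})] {n : ℕ}

/-- **`Hⁿ((⨁ᵢ Mᵢ)^{ab})` has no `m`-torsion if no `Hⁿ(Mᵢ^{ab})` has** (sheaves of modules).
[folklore] -/
theorem SheafOfModules.H_toSheaf_torsionFree_biproduct {m : ℤ}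
    (hM : ∀ i (y : ((SheafOfModules.toSheaf R).obj (M i)).H n), m • y = 0 → y = 0)
    (x : ((SheafOfModules.toSheaf R).obj (⨁ M)).H n) (hx : m • x = 0) : x = 0 :=
  let ⟨e⟩ := SheafOfModules.nonempty_toSheaf_biproduct_iso R M
  Sheaf.H.torsionFree_of_iso e.symm (Sheaf.H.torsionFree_biproduct _ hM) x hx

end

section Free

variable [J.WEqualsLocallyBijective AddCommGrpCat.{u}] (I : Type u)

section

variable [HasWeakSheafify J AddCommGrpCat.{u}]

/-- The free module `free I = ∐_{i ∈ I} R` is the biproduct `⨁_{i ∈ I} R` whenever the latter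
exists, e.g. for `I` finite (`biproduct.isoCoproduct`). [folklore] -/
theorem SheafOfModules.nonempty_free_iso_biproduct
    [HasBiproduct fun _ : I => SheafOfModules.unit R] :
    Nonempty (SheafOfModules.free (R := R) I ≅ ⨁ fun _ : I => SheafOfModules.unit R) :=
  ⟨(biproduct.isoCoproduct _).symm⟩

variable [Finite I]

/-- The underlying abelian sheaf of `free I` (`I` finite) is the direct sum of `I` copies of the
underlying abelian sheaf of `R`: `(R^I)^{ab} ≅ ⨁_{i ∈ I} R^{ab}`. [folklore] -/
theorem SheafOfModules.nonempty_toSheaf_free_iso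
    [HasBiproduct fun _ : I => (SheafOfModules.toSheaf R).obj (SheafOfModules.unit R)] :
    Nonempty ((SheafOfModules.toSheaf R).obj (SheafOfModules.free I) ≅
      ⨁ fun _ : I => (SheafOfModules.toSheaf R).obj (SheafOfModules.unit R)) := by
  haveI : HasFiniteBiproducts (SheafOfModules.{u} R) := HasFiniteBiproducts.of_hasFiniteProducts
  obtain ⟨e₁⟩ := SheafOfModules.nonempty_free_iso_biproduct R I
  obtain ⟨e₂⟩ :=
    SheafOfModules.nonempty_toSheaf_biproduct_iso R fun _ : I => SheafOfModules.unit R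
  exact ⟨(SheafOfModules.toSheaf R).mapIso e₁ ≪≫ e₂⟩

end

variable [Finite I] [HasSheafify J AddCommGrpCat.{u}] [HasExt.{w'} (Sheaf J AddCommGrpCat.{u})]
  {n : ℕ}

/-- **`Hⁿ(R^I)` is `m`-torsion-free if `Hⁿ(R)` is** (`I` finite; `R = unit R` the structure sheaf
as a module, `R^I = free I`, cohomology of the underlying abelian sheaves). [folklore] -/
theorem SheafOfModules.H_toSheaf_free_torsionFree {m : ℤ}
    (h : ∀ y : ((SheafOfModules.toSheaf R).obj (SheafOfModules.unit R)).H n, m • y = 0 → y = 0)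
    (x : ((SheafOfModules.toSheaf R).obj (SheafOfModules.free I)).H n) (hx : m • x = 0) :
    x = 0 := by
  haveI : HasFiniteBiproducts (Sheaf J AddCommGrpCat.{u}) := Abelian.hasFiniteBiproducts
  obtain ⟨e⟩ := SheafOfModules.nonempty_toSheaf_free_iso R I
  exact Sheaf.H.torsionFree_of_iso e.symm (Sheaf.H.torsionFree_biproduct _ fun _ => h) x hx

/-- Same for a module isomorphic to a free module of finite rank, `M ≅ R^I`. [folklore] -/
theorem SheafOfModules.H_toSheaf_torsionFree_of_iso_free {M : SheafOfModules.{u} R}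
    (e : M ≅ SheafOfModules.free I) {m : ℤ}
    (h : ∀ y : ((SheafOfModules.toSheaf R).obj (SheafOfModules.unit R)).H n, m • y = 0 → y = 0)
    (x : ((SheafOfModules.toSheaf R).obj M).H n) (hx : m • x = 0) : x = 0 :=
  Sheaf.H.torsionFree_of_iso ((SheafOfModules.toSheaf R).mapIso e).symm
    (SheafOfModules.H_toSheaf_free_torsionFree R I h) x hx

end Free

end SheafOfModules

end Literature.Algebra.Homology
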